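import Summits.CriticalPhenomena.PercolationContinuityZ3.Theorems.PercNearOneGluingAdditiveGluingFingerSetForm
import Summits.CriticalPhenomena.PercolationContinuityZ3.Theorems.PercNearOneGluingAdditiveGluingBlockMultiEdgeSplit
import HarnessLib

/-! # Crux `PercNearOneGluing.AdditiveGluing` (stmt-CriticalPhenomena-4576) — the stub `stub_fingerML3_vp` from the LINEAR CERTIFICATE (L2)
# (seat (b) V⁺-form, depth prover `png-dp-vplus`, gen 7)

Support file (`--supports stmt-CriticalPhenomena-4576`); no definitions, no named facts, no sorries.

Memo MEMO-gen7 (run/shared/lean/prim/prim-png-dp-vplus/) records the hypothesis-free inequality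

  (L2)  `μ_K(R ∩ {d↮N} ∩ {N↔b}) − μ_K(R ∩ {d↮N} ∩ {d↔b}) ≥ μ_K(R) · (μ_K(u_K↔b) − μ_K(d↔b))`,

`R` = some pair `N–A` open, `u_K` = the relay adjacent to `N` minimising `μ_K(·↔b)` (0 violations in ≈1.5·10⁴ exact instances and all annealing runs; it is
the registered stub made LINEAR: margin ≥ P(R)·(hypothesis slack), both signs).  Here we only record the (trivial) adapter: if (L2) holds at the designation
`d` for some vertex `u` with `μ_K(d↔b) ≤ μ_K(u↔b)`, then the set form of the stub holds, hence (`fingerML3_of_setForm`) the conclusion of `stub_fingerML3_vp`.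
So a proof of (L2) — conjecturally via the weakest-port gluing lemma (`pairGlue_real_ge`, `swap_real_le` are its landed cases) and the monotonicity of
`margin − μ(R)·slack` under deleting a contact — closes the stub for every number of relays.
[cite: KozmaNitzan2024, Thm 4 and Lemma 5 (§3.2, pp. 12–14)]
-/

namespace Summit.CriticalPhenomena.PercolationContinuityZ3.Theorems

open MeasureTheory Set
open Literature.Probability.LatticeModels (prodBernoulli)
open Literature.Probability.Percolation (BondConfig openConn openGraph)

noncomputable section
open Classical

section LinearCert

open Literature.Probability.LatticeModels Literature.Probability.Percolation

variable {n : ℕ}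

/-- **The stub from the linear certificate.**  If for some vertex `u` with `μ_K(d↔b) ≤ μ_K(u↔b)` the linear inequality
`μ_K(R) · (μ_K(u↔b) − μ_K(d↔b)) ≤ μ_K(R ∩ {d↮N} ∩ ⋃_{v∈N}{v↔b}) − μ_K(R ∩ {d↮N} ∩ {d↔b})` holds (`R` = some pair `N–A` open), then the conclusion of
`stub_fingerML3_vp` holds for `(K, A, N, d, b)`.  (With `u = u_K` the unglued-weakest relay this hypothesis is the conjectured certificate (L2) of memo
MEMO-gen7; under the stub's hypothesis `d` is weaker than every relay, so the left side is `≥ 0`.)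
[cite: KozmaNitzan2024, Thm 4 (pp. 12–14)] -/
theorem fingerML3_of_linearCert (K : Sym2 (Fin n) → unitInterval) (A N : Finset (Fin n)) (d b u : Fin n)
    (hNA : Disjoint N A)
    (hdu : (prodBernoulli K).real (openConn d b) ≤ (prodBernoulli K).real (openConn u b))
    (hL2 : (prodBernoulli K).real {ω : Set (Sym2 (Fin n)) | ∃ v ∈ N, ∃ a ∈ A, s(v, a) ∈ ω} *
        ((prodBernoulli K).real (openConn u b) - (prodBernoulli K).real (openConn d b)) ≤
      (prodBernoulli K).real
          ({ω : Set (Sym2 (Fin n)) | ∃ v ∈ N, ∃ a ∈ A, s(v, a) ∈ ω} ∩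
            {ω : BondConfig (Fin n) | ∀ x ∈ (↑N : Set (Fin n)), ¬ (openGraph ω).Reachable d x} ∩ ⋃ v ∈ N, openConn v b) -
        (prodBernoulli K).real
          ({ω : Set (Sym2 (Fin n)) | ∃ v ∈ N, ∃ a ∈ A, s(v, a) ∈ ω} ∩
            {ω : BondConfig (Fin n) | ∀ x ∈ (↑N : Set (Fin n)), ¬ (openGraph ω).Reachable d x} ∩ openConn d b)) :
    (prodBernoulli (fun e' : Sym2 (Fin n) => if (∀ y ∈ e', y ∈ N) ∧ ¬ e'.IsDiag then 1 else K e')).real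
        ({ω : Set (Sym2 (Fin n)) | ∃ v ∈ N, ∃ a ∈ A, s(v, a) ∈ ω} ∩ openConn d b) ≤
      (prodBernoulli (fun e' : Sym2 (Fin n) => if (∀ y ∈ e', y ∈ N) ∧ ¬ e'.IsDiag then 1 else K e')).real
        ({ω : Set (Sym2 (Fin n)) | ∃ v ∈ N, ∃ a ∈ A, s(v, a) ∈ ω} ∩ ⋃ v ∈ N, openConn v b) := by
  refine fingerML3_of_setForm K A N d b hNA ?_
  have h0 : 0 ≤ (prodBernoulli K).real {ω : Set (Sym2 (Fin n)) | ∃ v ∈ N, ∃ a ∈ A, s(v, a) ∈ ω} *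
      ((prodBernoulli K).real (openConn u b) - (prodBernoulli K).real (openConn d b)) :=
    mul_nonneg measureReal_nonneg (sub_nonneg.2 hdu)
  linarith

/-- **The stub from (L2) at a relay, under the stub's own hypothesis.**  If `d` is weaker than every relay of `A` (the hypothesis of
`stub_fingerML3_vp`) and the linear certificate holds for some relay `u ∈ A`, the stub's conclusion follows. [cite: KozmaNitzan2024, Thm 4 (pp. 12–14)] -/
theorem fingerML3_of_linearCert_relay (K : Sym2 (Fin n) → unitInterval) (A N : Finset (Fin n)) (d b u : Fin n)
    (hNA : Disjoint N A) (hu : u ∈ A)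
    (hmin : ∀ a ∈ A, (prodBernoulli K).real (openConn d b) ≤ (prodBernoulli K).real (openConn a b))
    (hL2 : (prodBernoulli K).real {ω : Set (Sym2 (Fin n)) | ∃ v ∈ N, ∃ a ∈ A, s(v, a) ∈ ω} *
        ((prodBernoulli K).real (openConn u b) - (prodBernoulli K).real (openConn d b)) ≤
      (prodBernoulli K).real
          ({ω : Set (Sym2 (Fin n)) | ∃ v ∈ N, ∃ a ∈ A, s(v, a) ∈ ω} ∩
            {ω : BondConfig (Fin n) | ∀ x ∈ (↑N : Set (Fin n)), ¬ (openGraph ω).Reachable d x} ∩ ⋃ v ∈ N, openConn v b) -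
        (prodBernoulli K).real
          ({ω : Set (Sym2 (Fin n)) | ∃ v ∈ N, ∃ a ∈ A, s(v, a) ∈ ω} ∩
            {ω : BondConfig (Fin n) | ∀ x ∈ (↑N : Set (Fin n)), ¬ (openGraph ω).Reachable d x} ∩ openConn d b)) :
    (prodBernoulli (fun e' : Sym2 (Fin n) => if (∀ y ∈ e', y ∈ N) ∧ ¬ e'.IsDiag then 1 else K e')).real
        ({ω : Set (Sym2 (Fin n)) | ∃ v ∈ N, ∃ a ∈ A, s(v, a) ∈ ω} ∩ openConn d b) ≤
      (prodBernoulli (fun e' : Sym2 (Fin n) => if (∀ y ∈ e', y ∈ N) ∧ ¬ e'.IsDiag then 1 else K e')).real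
        ({ω : Set (Sym2 (Fin n)) | ∃ v ∈ N, ∃ a ∈ A, s(v, a) ∈ ω} ∩ ⋃ v ∈ N, openConn v b) :=
  fingerML3_of_linearCert K A N d b u hNA (hmin u hu) hL2


/-- **Induction step for the linear certificate (contact / finger splitting).**  Let `F₁, F₂` be two sets of pairs (e.g. `F₁` = the pairs of
the block at its unglued-weakest contact, or the pairs of one finger), `R₁, R₂, R` = some pair of `F₁`, `F₂`, `F₁ ∪ F₂` open, `K ⊖ F₁ = pinW K F₁ ∅`
the weighting with `F₁` killed, and `Δ_p(F') := μ_p(R' ∩ {d↮N} ∩ {N↔b}) − μ_p(R' ∩ {d↮N} ∩ {d↔b})` the set-form margin.  If for reals `h, h'`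

  (Q♯)  `Δ_K(F₁) − μ_K(R₁)·h ≥ μ_K(R₁ᶜ)·(h − h')⁺`   and   (IH)  `Δ_{K⊖F₁}(F₂) ≥ μ_{K⊖F₁}(R₂)·h'`,

then `Δ_K(F₁ ∪ F₂) ≥ μ_K(R)·h`.  (Exact splitting `Δ_K(F₁∪F₂) = Δ_K(F₁) + μ_K(R₁ᶜ)·Δ_{K⊖F₁}(F₂)`, `μ_K(R) = μ_K(R₁) + μ_K(R₁ᶜ)·μ_{K⊖F₁}(R₂)`
— `contact_split` — and `(h − h')⁺ ≥ μ_{K⊖F₁}(R₂)·(h − h')`.)  With `h` = the hypothesis slack `min_contacts μ_K(·↔b) − μ_K(d↔b)` of `K` and `h'` that of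
`K ⊖ F₁`, (Q♯) is the hypothesis-free inequality of memo MEMO-gen7 §0 (0 violations when `F₁` = all pairs at the unglued-WEAKEST contact, or — for
pairwise non-adjacent fingers — all pairs of any one finger; false for other contacts and for single pairs); iterating this step down to `F = ∅` gives
the certificate (L2) consumed by `fingerML3_of_linearCert`. [cite: KozmaNitzan2024, §4 p. 20 (conditioning on the pattern of a pair set)] -/
theorem linearCert_split_step (K : Sym2 (Fin n) → unitInterval) (N : Finset (Fin n)) (F₁ F₂ : Finset (Sym2 (Fin n))) (d b : Fin n)
    (h h' : ℝ)
    (hQ : (prodBernoulli K).real ({ω : Set (Sym2 (Fin n)) | ∃ e ∈ F₁, e ∈ ω} ∩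
            ({ω : BondConfig (Fin n) | ∀ x ∈ (↑N : Set (Fin n)), ¬ (openGraph ω).Reachable d x} ∩ ⋃ v ∈ N, openConn v b)) -
          (prodBernoulli K).real ({ω : Set (Sym2 (Fin n)) | ∃ e ∈ F₁, e ∈ ω} ∩
            ({ω : BondConfig (Fin n) | ∀ x ∈ (↑N : Set (Fin n)), ¬ (openGraph ω).Reachable d x} ∩ openConn d b)) -
          (prodBernoulli K).real {ω : Set (Sym2 (Fin n)) | ∃ e ∈ F₁, e ∈ ω} * h ≥
        (prodBernoulli K).real ({ω : Set (Sym2 (Fin n)) | ∃ e ∈ F₁, e ∈ ω}ᶜ : Set (BondConfig (Fin n))) * max 0 (h - h'))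
    (hIH : (prodBernoulli (pinW K (↑F₁ : Set (Sym2 (Fin n))) (∅ : Set (Sym2 (Fin n))))).real ({ω : Set (Sym2 (Fin n)) | ∃ e ∈ F₂, e ∈ ω} ∩
            ({ω : BondConfig (Fin n) | ∀ x ∈ (↑N : Set (Fin n)), ¬ (openGraph ω).Reachable d x} ∩ ⋃ v ∈ N, openConn v b)) -
          (prodBernoulli (pinW K (↑F₁ : Set (Sym2 (Fin n))) (∅ : Set (Sym2 (Fin n))))).real ({ω : Set (Sym2 (Fin n)) | ∃ e ∈ F₂, e ∈ ω} ∩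
            ({ω : BondConfig (Fin n) | ∀ x ∈ (↑N : Set (Fin n)), ¬ (openGraph ω).Reachable d x} ∩ openConn d b)) ≥
        (prodBernoulli (pinW K (↑F₁ : Set (Sym2 (Fin n))) (∅ : Set (Sym2 (Fin n))))).real {ω : Set (Sym2 (Fin n)) | ∃ e ∈ F₂, e ∈ ω} * h') :
    (prodBernoulli K).real ({ω : Set (Sym2 (Fin n)) | ∃ e ∈ F₁ ∪ F₂, e ∈ ω} ∩
          ({ω : BondConfig (Fin n) | ∀ x ∈ (↑N : Set (Fin n)), ¬ (openGraph ω).Reachable d x} ∩ ⋃ v ∈ N, openConn v b)) -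
        (prodBernoulli K).real ({ω : Set (Sym2 (Fin n)) | ∃ e ∈ F₁ ∪ F₂, e ∈ ω} ∩
          ({ω : BondConfig (Fin n) | ∀ x ∈ (↑N : Set (Fin n)), ¬ (openGraph ω).Reachable d x} ∩ openConn d b)) ≥
      (prodBernoulli K).real {ω : Set (Sym2 (Fin n)) | ∃ e ∈ F₁ ∪ F₂, e ∈ ω} * h := by
  set μ := prodBernoulli K with hμ
  set μ' := prodBernoulli (pinW K (↑F₁ : Set (Sym2 (Fin n))) (∅ : Set (Sym2 (Fin n)))) with hμ'
  set EU : Set (BondConfig (Fin n)) :=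
    {ω : BondConfig (Fin n) | ∀ x ∈ (↑N : Set (Fin n)), ¬ (openGraph ω).Reachable d x} ∩ ⋃ v ∈ N, openConn v b with hEU
  set EX : Set (BondConfig (Fin n)) :=
    {ω : BondConfig (Fin n) | ∀ x ∈ (↑N : Set (Fin n)), ¬ (openGraph ω).Reachable d x} ∩ openConn d b with hEX
  set R₁ : Set (BondConfig (Fin n)) := {ω : Set (Sym2 (Fin n)) | ∃ e ∈ F₁, e ∈ ω} with hR₁
  set R₂ : Set (BondConfig (Fin n)) := {ω : Set (Sym2 (Fin n)) | ∃ e ∈ F₂, e ∈ ω} with hR₂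
  set R : Set (BondConfig (Fin n)) := {ω : Set (Sym2 (Fin n)) | ∃ e ∈ F₁ ∪ F₂, e ∈ ω} with hR
  -- exact splittings over `F₁`
  have hsU : μ.real (R ∩ EU) = μ.real (R₁ ∩ EU) + μ.real R₁ᶜ * μ'.real (R₂ ∩ EU) := contact_split K F₁ F₂ EU
  have hsX : μ.real (R ∩ EX) = μ.real (R₁ ∩ EX) + μ.real R₁ᶜ * μ'.real (R₂ ∩ EX) := contact_split K F₁ F₂ EX
  have hsR : μ.real R = μ.real R₁ + μ.real R₁ᶜ * μ'.real R₂ := by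
    have := contact_split K F₁ F₂ (Set.univ : Set (BondConfig (Fin n)))
    simpa only [Set.inter_univ] using this
  -- signs and bounds
  have hc0 : 0 ≤ μ.real R₁ᶜ := measureReal_nonneg
  have hP0 : 0 ≤ μ'.real R₂ := measureReal_nonneg
  have hP1 : μ'.real R₂ ≤ 1 := measureReal_le_one
  have hmax : μ'.real R₂ * (h - h') ≤ max 0 (h - h') := by
    by_cases hh : h' ≤ h
    · calc μ'.real R₂ * (h - h') ≤ 1 * (h - h') := mul_le_mul_of_nonneg_right hP1 (by linarith)
        _ = h - h' := one_mul _
        _ ≤ max 0 (h - h') := le_max_right _ _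
    · have : μ'.real R₂ * (h - h') ≤ 0 := mul_nonpos_of_nonneg_of_nonpos hP0 (by linarith)
      exact this.trans (le_max_left _ _)
  have hkey : μ.real R₁ᶜ * (μ'.real R₂ * (h - h')) ≤ μ.real R₁ᶜ * max 0 (h - h') :=
    mul_le_mul_of_nonneg_left hmax hc0
  have hIH' : μ.real R₁ᶜ * (μ'.real (R₂ ∩ EU) - μ'.real (R₂ ∩ EX)) ≥ μ.real R₁ᶜ * (μ'.real R₂ * h') :=
    mul_le_mul_of_nonneg_left hIH hc0
  rw [hsU, hsX, hsR]
  nlinarith [hQ, hIH', hkey, hc0]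

end LinearCert

end

end Summit.CriticalPhenomena.PercolationContinuityZ3.Theorems
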